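import Summits.BirchSwinnertonDyer.BirchSwinnertonDyer.Theorems.ManinLocalTwoThreeThreeShiftStepNine
import HarnessLib

/-!
# THEOREM V — E-es-106 `ThreeShiftAntiInvariantDescentAll` at `3 ∥ M`: the anti-invariant descent `Γ₀(9N₀) → Γ₀(3N₀)` (`3 ∤ N₀`)
# (route `ManinLocalTwoThree`, cell bsd-f2-manin; crux C3 `ManinPrimeToThreeAtNine` stmt-BirchSwinnertonDyer-22968; es g23, MEMO-es §37.13 (B))

For `3 ∤ N₀`, every additive 3-shift-ANTI-invariant `ψ : Γ₀(9N₀) → 𝔽₃` is the restriction of an additive 3-shift-anti-invariant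
`w : Γ₀(3N₀) → 𝔽₃` (**`threeShiftAntiInvariantDescent_of_not_three_dvd`**; the `3 ∥ M` case of the typed row E-es-106
`NineShiftEqualiser.ThreeShiftAntiInvariantDescentAll`, **`threeShiftAntiInvariantDescentAll_of_not_nine_dvd`**).  PROOF = p3's descent
engine `ThreeShiftDescent.descent` (ε = −1; it needs only `ψ(P_{2/3}) = ψ(P_{1/3})`) + es's «two functionals and ONE explicit pair»
(MEMO-es §37.13 (A)–(B)): on `G = Γ₀(3N₀) ⊇ A = {3 ∣ b}, B = Γ₀(9N₀)` the function `χ_G := χ₉ ∘ d` (p3's `chi9`) is additive on `A` and on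
`B` (not on `G`); if `ψ(P_{2/3}) ≠ ψ(P_{1/3})`, the compatible pair `(χ_G − c·(−coshift ψ), χ_G − c·ψ)` with
`c := (χ₉(1+6N₀) − χ₉(1+3N₀))·(ψ(P_{1/3}) − ψ(P_{2/3}))⁻¹` passes p3's `κ`-test, hence glues (`ThreeShiftDescent.glue`) to an additive
`W` on `G`; evaluating `W` at `P_{2/3} = h P_{1/3} h⁻¹` with the EXPLICIT `h = (−6j−1, 2j+1; −9j−3, 3j+2) ∈ Γ₀(3N₀)` (`N₀ ∣ 3j+1`) gives
`χ₉(1+6N₀) − χ₉(1+3N₀) = −(χ₉(1+6N₀) − χ₉(1+3N₀))`, i.e. `= 0`, contradicting p3's `chiNine_P23_sub_P13_ne_zero` (`3 ∤ N₀`).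
Elementary; no Bass–Serre, no dimension count.  Nothing else: E-es-106 at `9 ∣ M`, E-es-94♯, C3 are NOT proved here; BSD is not proved
by this; Manin's conjecture is not proved by this.  Reference: HOME/MEMO-es.md §37.8, §37.13 [cite: DarmonDiamondTaylor1995, Lemma 4.28 (p. 135)].
-/

set_option autoImplicit false
set_option linter.dupNamespace false

open scoped MatrixGroups

open CongruenceSubgroup Matrix.SpecialLinearGroup
  Summit.BirchSwinnertonDyer.Rank1Residual.ManinAdditive.NineShiftEqualiser

namespace Summit.BirchSwinnertonDyer.BirchSwinnertonDyer.Theorems.ManinLocalTwoThree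

namespace ThreeShiftDescent

variable {N₀ : ℕ}

/-! ### §1. `χ_G = χ₉ ∘ d` on `Γ₀(3N₀)`: additive on `A` and on `B` -/

/-- `χ_G(γ) := χ₉(d_γ mod 9)` on `Γ₀(3N₀)` (the restriction pair of the Heisenberg lift; NOT additive on `Γ₀(3N₀)`). [folklore] -/
def chiG (N₀ : ℕ) (γ : Gamma0 (3 * N₀)) : ZMod 3 := chi9 (((γ : SL(2, ℤ)) 1 1 : ℤ) : ZMod 9)

/-- For `(a b; c d)` of determinant `1` with `3 ∣ c`: `d⁶ = 1` in `ℤ/9` (`d · a(1 − bc) = 1 − b²c² ≡ 1 (mod 9)`). [folklore] -/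
theorem pow_six_eq_one_of_det {a b c d : ℤ} (h : a * d - b * c = 1) (hc : ((3 * N₀ : ℕ) : ℤ) ∣ c) :
    ((d : ℤ) : ZMod 9) ^ 6 = 1 := by
  obtain ⟨k, hk⟩ : (3 : ℤ) ∣ c := (show (3 : ℤ) ∣ ((3 * N₀ : ℕ) : ℤ) from ⟨N₀, by push_cast; ring⟩).trans hc
  subst hk
  have key : (a * (1 - b * (3 * k))) * d = 1 + 9 * (-(b * b * k * k)) := by
    linear_combination (1 - 3 * b * k) * h
  refine pow_six_eq_one_of_mul_eq_one (((a * (1 - b * (3 * k)) : ℤ)) : ZMod 9) _ ?_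
  have := congrArg (fun x : ℤ => (x : ZMod 9)) key
  push_cast at this ⊢
  rw [show (9 : ZMod 9) = 0 from rfl, zero_mul, add_zero] at this
  exact this

/-- `d_γ⁶ = 1` in `ℤ/9` for `γ ∈ Γ₀(3N₀)`. [folklore] -/
theorem pow_six_entry (γ : Gamma0 (3 * N₀)) : ((((γ : SL(2, ℤ)) 1 1 : ℤ)) : ZMod 9) ^ 6 = 1 :=
  pow_six_eq_one_of_det (N₀ := N₀) (gamma0_det_entries γ)
    ((ZMod.intCast_zmod_eq_zero_iff_dvd _ _).mp (Gamma0_mem.mp γ.2))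

/-- The `d`-entry of a product, and its class mod `9` when `9 ∣ c_x b_y`. [folklore] -/
theorem chiG_mul_of_nine_dvd (x y : Gamma0 (3 * N₀))
    (h9 : ((9 : ℕ) : ℤ) ∣ ((x : SL(2, ℤ)) 1 0 : ℤ) * (y : SL(2, ℤ)) 0 1) :
    chiG N₀ (x * y) = chiG N₀ x + chiG N₀ y := by
  unfold chiG
  have e : (((x * y : Gamma0 (3 * N₀)) : SL(2, ℤ)) 1 1 : ℤ) =
      (x : SL(2, ℤ)) 1 0 * (y : SL(2, ℤ)) 0 1 + (x : SL(2, ℤ)) 1 1 * (y : SL(2, ℤ)) 1 1 := by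
    simp [Matrix.mul_apply, Fin.sum_univ_two]
  rw [e, Int.cast_add, (ZMod.intCast_zmod_eq_zero_iff_dvd _ 9).mpr h9, zero_add, Int.cast_mul]
  exact chi9_mul _ _ (pow_six_entry x) (pow_six_entry y)

/-- `χ_G` is additive on `A = {3 ∣ b}` (`9 ∣ c_x b_y` as `3N₀ ∣ c_x`, `3 ∣ b_y`). [folklore] -/
theorem chiG_add_subA : ∀ x ∈ subA N₀, ∀ y ∈ subA N₀, chiG N₀ (x * y) = chiG N₀ x + chiG N₀ y := by
  intro x hx y hy
  refine chiG_mul_of_nine_dvd x y ?_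
  obtain ⟨u, hu⟩ : ((3 * N₀ : ℕ) : ℤ) ∣ ((x : SL(2, ℤ)) 1 0 : ℤ) :=
    (ZMod.intCast_zmod_eq_zero_iff_dvd _ _).mp (Gamma0_mem.mp x.2)
  obtain ⟨v, hv⟩ := (mem_subA N₀).mp hy
  exact ⟨N₀ * u * v, by rw [hu, hv]; push_cast; ring⟩

/-- `χ_G` is additive on `B = Γ₀(9N₀)` (`9 ∣ c_x`). [folklore] -/
theorem chiG_add_subB : ∀ x ∈ subB N₀, ∀ y ∈ subB N₀, chiG N₀ (x * y) = chiG N₀ x + chiG N₀ y := by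
  intro x hx y hy
  refine chiG_mul_of_nine_dvd x y ?_
  obtain ⟨u, hu⟩ := (mem_subB N₀).mp hx
  exact ⟨N₀ * u * (y : SL(2, ℤ)) 0 1, by rw [hu]; push_cast; ring⟩

/-- `χ_G(Q₁) = χ₉(1 + 3N₀)`. [folklore] -/
theorem chiG_Q1 : chiG N₀ (Q1 N₀) = chi9 (((1 + 3 * N₀ : ℤ)) : ZMod 9) := rfl

/-- `χ_G(T Q₁ T⁻¹) = χ₉(1 + 6N₀)`. [folklore] -/
theorem chiG_conj_Q1 :
    chiG N₀ (Tpow (3 * N₀) 1 * Q1 N₀ * (Tpow (3 * N₀) 1)⁻¹) = chi9 (((1 + 6 * N₀ : ℤ)) : ZMod 9) := by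
  rw [Tpow_inv, Q1, Tpow_one_mul_mul_Tpow_neg_one _ _ _ _ _ _ (by ring)]
  show chi9 ((((1 + 3 * (N₀ : ℤ) - -(3 * (N₀ : ℤ))) : ℤ)) : ZMod 9) = _
  congr 2
  ring

/-! ### §2. The parabolics `P_{1/3}`, `P_{2/3}` inside `Γ₀(3N₀)` and the explicit conjugator `h` -/

/-- `P_{1/3}` as an element of `Γ₀(3N₀)` (it lies in `B = Γ₀(9N₀)`). [folklore] -/
def P13' (N₀ : ℕ) : Gamma0 (3 * N₀) :=
  g0Of (1 - 3 * N₀) N₀ (-(9 * N₀)) (1 + 3 * N₀) (by ring) ⟨-3, by push_cast; ring⟩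

/-- `P_{2/3}` as an element of `Γ₀(3N₀)`. [folklore] -/
def P23' (N₀ : ℕ) : Gamma0 (3 * N₀) :=
  g0Of (1 - 6 * N₀) (4 * N₀) (-(9 * N₀)) (1 + 6 * N₀) (by ring) ⟨-3, by push_cast; ring⟩

/-- `P_{1/3} ∈ B`. [folklore] -/
theorem P13'_mem_subB : P13' N₀ ∈ subB N₀ := g0Of_mem_subB _ _ _ _ _ _ ⟨-1, by push_cast; ring⟩

/-- `P_{2/3} ∈ B`. [folklore] -/
theorem P23'_mem_subB : P23' N₀ ∈ subB N₀ := g0Of_mem_subB _ _ _ _ _ _ ⟨-1, by push_cast; ring⟩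

/-- `restrVal ψ P_{1/3} = ψ(P_{1/3})`. [folklore] -/
theorem restrVal_P13' (ψ : Gamma0 (3 * (3 * N₀)) → ZMod 3) : restrVal ψ (P13' N₀) = ψ (P13 N₀) := by
  rw [P13', restrVal_g0Of ψ _ _ _ _ _ _ ⟨-1, by push_cast; ring⟩]
  rfl

/-- `restrVal ψ P_{2/3} = ψ(P_{2/3})`. [folklore] -/
theorem restrVal_P23' (ψ : Gamma0 (3 * (3 * N₀)) → ZMod 3) : restrVal ψ (P23' N₀) = ψ (P23 N₀) := by
  rw [P23', restrVal_g0Of ψ _ _ _ _ _ _ ⟨-1, by push_cast; ring⟩]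
  rfl

/-- `χ_G(P_{1/3}) = χ₉(1 + 3N₀)`. [folklore] -/
theorem chiG_P13' : chiG N₀ (P13' N₀) = chi9 (((1 + 3 * N₀ : ℤ)) : ZMod 9) := rfl

/-- `χ_G(P_{2/3}) = χ₉(1 + 6N₀)`. [folklore] -/
theorem chiG_P23' : chiG N₀ (P23' N₀) = chi9 (((1 + 6 * N₀ : ℤ)) : ZMod 9) := rfl

/-- **The explicit conjugator** `h = (−6j−1, 2j+1; −9j−3, 3j+2) ∈ Γ₀(3N₀)` for `N₀ ∣ 3j + 1` (`c_h = −3(3j+1)`). [folklore] -/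
def hEl (N₀ : ℕ) (j k : ℤ) (hjk : 3 * j + 1 = (N₀ : ℤ) * k) : Gamma0 (3 * N₀) :=
  g0Of (-6 * j - 1) (2 * j + 1) (-9 * j - 3) (3 * j + 2) (by ring)
    ⟨-k, by push_cast; linear_combination (-3) * hjk⟩

/-- **`h P_{1/3} = P_{2/3} h`** in `Γ₀(3N₀)` (`h(1,3)ᵀ = (2,3)ᵀ`, `(−3,2)h = (−3,1)`; a polynomial identity in `j, N₀`). [folklore] -/
theorem hEl_mul_P13' (j k : ℤ) (hjk : 3 * j + 1 = (N₀ : ℤ) * k) :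
    hEl N₀ j k hjk * P13' N₀ = P23' N₀ * hEl N₀ j k hjk := by
  unfold hEl P13' P23'
  rw [g0Of_mul _ _ _ _ _ _ _ _ _ _ _ _ (det_mul_entries (by ring) (by ring))
      (dvd_add (Dvd.dvd.mul_right ⟨-k, by push_cast; linear_combination (-3) * hjk⟩ _)
        (Dvd.dvd.mul_left ⟨-3, by push_cast; ring⟩ _)),
    g0Of_mul _ _ _ _ _ _ _ _ _ _ _ _ (det_mul_entries (by ring) (by ring))
      (dvd_add (Dvd.dvd.mul_right ⟨-3, by push_cast; ring⟩ _)
        (Dvd.dvd.mul_left ⟨-k, by push_cast; linear_combination (-3) * hjk⟩ _))]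
  exact g0Of_congr (by ring) (by ring) (by ring) (by ring) _ _ _ _

/-- `3 ∤ N₀` gives `j, k` with `3j + 1 = N₀ k`. [folklore] -/
theorem exists_three_mul_add_one (h3 : ¬ 3 ∣ N₀) : ∃ j k : ℤ, 3 * j + 1 = (N₀ : ℤ) * k := by
  rcases (show N₀ % 3 = 1 ∨ N₀ % 3 = 2 by omega) with h | h
  · exact ⟨((N₀ / 3 : ℕ) : ℤ), 1, by omega⟩
  · exact ⟨2 * ((N₀ / 3 : ℕ) : ℤ) + 1, 2, by omega⟩

/-! ### §3. THEOREM V -/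

/-- **The two-functional argument** (MEMO-es §37.13 (A)–(B)): for `3 ∤ N₀`, an additive `ψ` on `Γ₀(9N₀)` that is ANTI-invariant under the
3-shift satisfies the descent condition `ψ(P_{2/3}) = ψ(P_{1/3})` of `ThreeShiftDescent.descent`. [folklore] -/
theorem apply_P23_eq_apply_P13_of_anti (h3 : ¬ 3 ∣ N₀) (ψ : Gamma0 (3 * (3 * N₀)) → ZMod 3) (hadd : IsAddChar ψ)
    (hinv : ∀ (a b c d : ℤ) (h : a * d - b * (3 * c) = 1) (hc : ((3 * (3 * N₀) : ℕ) : ℤ) ∣ c),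
      ψ (g0Of a (3 * b) c d (by linear_combination h) hc) = (-1) * ψ (g0Of a b (3 * c) d h (Dvd.dvd.mul_left hc 3))) :
    ψ (P23 N₀) = ψ (P13 N₀) := by
  by_contra hne
  obtain ⟨j, k, hjk⟩ := exists_three_mul_add_one h3
  have hAn := subA_normal N₀
  have hα := alpha_add (m := N₀) ψ (-1) hadd
  have hφ' := restr_add (m := N₀) ψ hadd
  have hC := alpha_eq_restr (m := N₀) ψ (-1) hinv
  have ht : Tpow (3 * N₀) 1 ∈ subB N₀ := Tpow_mem_subB 1
  -- the two non-zero quantities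
  have hD : (-1) * ψ (P23 N₀) - (-1) * ψ (P13 N₀) ≠ 0 := by
    intro h0; apply hne; linear_combination -h0
  have hX : chi9 (((1 + 6 * N₀ : ℤ)) : ZMod 9) - chi9 (((1 + 3 * N₀ : ℤ)) : ZMod 9) ≠ 0 :=
    chiNine_P23_sub_P13_ne_zero h3
  -- the corrected pair `(α₂, φ₂) = (χ_G, χ_G) − cst · (−coshift ψ, ψ)`
  set cst : ZMod 3 := (chi9 (((1 + 6 * N₀ : ℤ)) : ZMod 9) - chi9 (((1 + 3 * N₀ : ℤ)) : ZMod 9)) *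
    ((-1) * ψ (P23 N₀) - (-1) * ψ (P13 N₀))⁻¹ with hcst
  set α₂ : Gamma0 (3 * N₀) → ZMod 3 := fun g => chiG N₀ g - cst * ((-1) * coshiftVal ψ g) with hα₂
  set φ₂ : Gamma0 (3 * N₀) → ZMod 3 := fun g => chiG N₀ g - cst * restrVal ψ g with hφ₂
  have hα₂A : ∀ x ∈ subA N₀, ∀ y ∈ subA N₀, α₂ (x * y) = α₂ x + α₂ y := by
    intro x hx y hy
    simp only [hα₂, chiG_add_subA x hx y hy, hα x hx y hy]
    ring
  have hφ₂B : ∀ x ∈ subB N₀, ∀ y ∈ subB N₀, φ₂ (x * y) = φ₂ x + φ₂ y := by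
    intro x hx y hy
    simp only [hφ₂, chiG_add_subB x hx y hy, hφ' x hx y hy]
    ring
  have hC₂ : ∀ x ∈ subA N₀, x ∈ subB N₀ → α₂ x = φ₂ x := by
    intro x hx hxB
    simp only [hα₂, hφ₂, hC x hx hxB]
  -- the `κ`-test: `α₂(T Q₁ T⁻¹) = α₂(Q₁)` by the choice of `cst`
  have hκ : α₂ (Tpow (3 * N₀) 1 * Q1 N₀ * (Tpow (3 * N₀) 1)⁻¹) = α₂ (Q1 N₀) := by
    simp only [hα₂]
    rw [chiG_conj_Q1, chiG_Q1, coshiftVal_conj_Q1, coshiftVal_Q1, sub_eq_sub_iff_sub_eq_sub, ← mul_sub, hcst,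
      mul_assoc, inv_mul_cancel₀ hD, mul_one]
  have hinvT := conj_invariant_of_generator hAn hα₂A hφ₂B hC₂ ht Q1_mem_subA exists_mul_Q1_zpow_mem_subB hκ
  obtain ⟨hW, -, hWB⟩ := glue hAn hα₂A hφ₂B hC₂ ht hinvT
    (fun g => ((g : SL(2, ℤ)) 0 0 : ℤ) * (g : SL(2, ℤ)) 0 1) mul_Tpow_neg_mem_subA Tpow_n_mem_subA
  -- evaluate the glued additive function on `h P_{1/3} = P_{2/3} h`
  have h1 := hW (hEl N₀ j k hjk) (P13' N₀)
  have h2 := hW (P23' N₀) (hEl N₀ j k hjk)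
  rw [hEl_mul_P13' j k hjk] at h1
  have h12 := h1.symm.trans h2
  rw [hWB _ P13'_mem_subB, hWB _ P23'_mem_subB] at h12
  -- `h12 : W h + φ₂ P_{1/3} = φ₂ P_{2/3} + W h`
  have hPP : φ₂ (P13' N₀) = φ₂ (P23' N₀) := by linear_combination h12
  simp only [hφ₂, chiG_P13', chiG_P23', restrVal_P13', restrVal_P23'] at hPP
  -- `hPP : χ₉(1+3N₀) − cst·ψ(P_{1/3}) = χ₉(1+6N₀) − cst·ψ(P_{2/3})`, and `cst·(ψ P23 − ψ P13) = −X`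
  have hcD : cst * ((-1) * ψ (P23 N₀) - (-1) * ψ (P13 N₀)) =
      chi9 (((1 + 6 * N₀ : ℤ)) : ZMod 9) - chi9 (((1 + 3 * N₀ : ℤ)) : ZMod 9) := by
    rw [hcst, mul_assoc, inv_mul_cancel₀ hD, mul_one]
  have hXX : chi9 (((1 + 6 * N₀ : ℤ)) : ZMod 9) - chi9 (((1 + 3 * N₀ : ℤ)) : ZMod 9) =
      -(chi9 (((1 + 6 * N₀ : ℤ)) : ZMod 9) - chi9 (((1 + 3 * N₀ : ℤ)) : ZMod 9)) := by
    linear_combination hPP.symm - hcD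
  have key : ∀ x : ZMod 3, x = -x → x = 0 := by decide
  exact hX (key _ hXX)

/-- **THEOREM V (es, MEMO-es §37.8/§37.13): anti-invariant descent `Γ₀(9N₀) → Γ₀(3N₀)` for `3 ∤ N₀`.**  Every additive
3-shift-anti-invariant `ψ : Γ₀(9N₀) → 𝔽₃` is the restriction of an additive 3-shift-anti-invariant `w : Γ₀(3N₀) → 𝔽₃`. [folklore] -/
theorem threeShiftAntiInvariantDescent_of_not_three_dvd (N₀ : ℕ) (h3 : ¬ 3 ∣ N₀)
    (ψ : Gamma0 (3 * (3 * N₀)) → ZMod 3) (hadd : IsAddChar ψ) (hanti : IsThreeShiftAntiInvariant ψ) :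
    ∃ w : Gamma0 (3 * N₀) → ZMod 3, IsAddChar w ∧ IsThreeShiftAntiInvariant w ∧ RestrictsFrom ψ w := by
  have hinv : ∀ (a b c d : ℤ) (h : a * d - b * (3 * c) = 1) (hc : ((3 * (3 * N₀) : ℕ) : ℤ) ∣ c),
      ψ (g0Of a (3 * b) c d (by linear_combination h) hc) = (-1) * ψ (g0Of a b (3 * c) d h (Dvd.dvd.mul_left hc 3)) :=
    fun a b c d h hc => by rw [hanti a b c d h hc, neg_one_mul]
  obtain ⟨w, hwadd, hwε, hres⟩ := descent ψ (-1) hadd hinv (apply_P23_eq_apply_P13_of_anti h3 ψ hadd hinv)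
  exact ⟨w, hwadd, fun a b c d h hc => by rw [hwε a b c d h hc, neg_one_mul], hres⟩

end ThreeShiftDescent

open ThreeShiftDescent in
/-- **E-es-106 `ThreeShiftAntiInvariantDescentAll` at `3 ∥ M`** (the typed row's shape, restricted to `9 ∤ M`): for `3 ∣ M`, `9 ∤ M`,
`N = 3M`, every additive 3-shift-anti-invariant `ψ : Γ₀(N) → 𝔽₃` restricts from an additive 3-shift-anti-invariant `w` on `Γ₀(M)`.
(The cases `27 ∣ M` are p3's `threeShiftAntiInvariantDescent_holds`; the case `9 ∥ M` stays OPEN.) [folklore] -/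
theorem threeShiftAntiInvariantDescentAll_of_not_nine_dvd (M N : ℕ) (h3 : 3 ∣ M) (h9 : ¬ 9 ∣ M) (hN : N = 3 * M)
    (ψ : Gamma0 N → ZMod 3) (hadd : IsAddChar ψ) (hanti : IsThreeShiftAntiInvariant ψ) :
    ∃ w : Gamma0 M → ZMod 3, IsAddChar w ∧ IsThreeShiftAntiInvariant w ∧ RestrictsFrom ψ w := by
  obtain ⟨N₀, rfl⟩ := h3
  subst hN
  have h3' : ¬ 3 ∣ N₀ := fun ⟨q, hq⟩ => h9 ⟨q, by rw [hq]; ring⟩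
  exact threeShiftAntiInvariantDescent_of_not_three_dvd N₀ h3' ψ hadd hanti

/-! ### §4. Consequences for the anti-invariant tower (obligation bookkeeping; nothing new asserted) -/

open ThreeShiftDescent in
/-- **`K₃⁻(9N₀) = 0` for `3 ∤ N₀`**, from THEOREM V + the cube anti-step (E-es-104 `CubeStepAntiDescent`, hypothesis) + the base
(E-es-102 `ThreeShiftBasePrimeToThree`, hypothesis). [folklore] -/
theorem antiInvariantTrivialAt_nine (hcube : CubeStepAntiDescent) (hbase : ThreeShiftBasePrimeToThree)
    (N₀ : ℕ) (hN₀ : 0 < N₀) (h3 : ¬ 3 ∣ N₀) : ThreeShiftAntiInvariantTrivialAt (3 * (3 * N₀)) := by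
  intro ψ hadd hanti γ
  obtain ⟨w, hwadd, hwanti, hres⟩ := threeShiftAntiInvariantDescent_of_not_three_dvd N₀ h3 ψ hadd hanti
  obtain ⟨v, hvadd, hvanti, hres'⟩ := hcube N₀ (3 * N₀) hN₀ h3 rfl w hwadd hwanti
  have hv0 : ∀ δ, v δ = 0 := (hbase N₀ hN₀ h3).2 v hvadd hvanti
  have hw0 : ∀ δ, w δ = 0 := fun δ => eq_zero_of_restrictsFrom (dvd_mul_left N₀ 3) hres' hv0 δ
  exact eq_zero_of_restrictsFrom ⟨3, by ring⟩ hres hw0 γ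

/-- **p3's base law `AntiInvariantBaseTwentySeven` (`K₃⁻(27N₀) = 0`, `3 ∤ N₀`) ⟸ the SINGLE anti-step `Γ₀(27N₀) → Γ₀(9N₀)`** (the
`9 ∥ M` case of E-es-106, hypothesis `hstep` — OPEN, needs a non-congruence witness, MEMO-es §37.13 (C)) + cube anti-step + base.
[folklore] -/
theorem antiInvariantBaseTwentySeven_of_step
    (hstep : ∀ N₀ : ℕ, 0 < N₀ → ¬ 3 ∣ N₀ → ∀ ψ : Gamma0 (3 * (3 * (3 * N₀))) → ZMod 3, IsAddChar ψ →
      IsThreeShiftAntiInvariant ψ →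
        ∃ w : Gamma0 (3 * (3 * N₀)) → ZMod 3, IsAddChar w ∧ IsThreeShiftAntiInvariant w ∧ RestrictsFrom ψ w)
    (hcube : CubeStepAntiDescent) (hbase : ThreeShiftBasePrimeToThree) : AntiInvariantBaseTwentySeven := by
  intro N₀ hN₀ h3
  rw [show 27 * N₀ = 3 * (3 * (3 * N₀)) by ring]
  intro ψ hadd hanti γ
  obtain ⟨w, hwadd, hwanti, hres⟩ := hstep N₀ hN₀ h3 ψ hadd hanti
  exact eq_zero_of_restrictsFrom ⟨3, by ring⟩ hres (antiInvariantTrivialAt_nine hcube hbase N₀ hN₀ h3 w hwadd hwanti) γ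

/-- The same with the typed row E-es-106 `ThreeShiftAntiInvariantDescentAll` in place of the single step. [folklore] -/
theorem antiInvariantBaseTwentySeven_of_descentAll (hVI : ThreeShiftAntiInvariantDescentAll)
    (hcube : CubeStepAntiDescent) (hbase : ThreeShiftBasePrimeToThree) : AntiInvariantBaseTwentySeven :=
  antiInvariantBaseTwentySeven_of_step
    (fun N₀ _ _ ψ hadd hanti => hVI (3 * (3 * N₀)) (3 * (3 * (3 * N₀))) ⟨3 * N₀, by ring⟩ rfl ψ hadd hanti) hcube hbase

end Summit.BirchSwinnertonDyer.BirchSwinnertonDyer.Theorems.ManinLocalTwoThree
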